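/- Copyright: the b2b-balaban cell (near-miss cell 7), T⁴-continuum fan-out, lineage t4-ne7b-p1 (node U5c COUNT
member).  Released under the licence of the surrounding project. -/
import Literature.MathematicalPhysics.QuantumFieldTheory.Balaban1983to89.B16MergeGeometry

/-!
# M5-1b (G1) — THE VOLUME OF A FATTENED TOUCH-CONNECTED SET OF CUBES: `|⋃_{p ∈ P} □_p^{~r}| ≤ (2r+1)^d +
(|P| − 1)·d·(2r+1)^{d−1}` (owner module of row NE7b, lineage `t4-ne7b-p1` gen 42; re-open object (α),
`SCOPE-alpha.md` v2.4.1 STATE (3)(i), ruling R-OWNER-42-2 «M5's cost side in TOTAL form», precision E-OWNER-42-1 —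
PRE-POSITIONING ONLY)

Summits-side support leaf of the T⁴-continuum cell (rung (B)+1 on a FINITE torus only; NOT infinite volume, NOT the
mass gap, NOT the Clay statement; NOT a proof of the spine estimate NE7b, which is the cell's OWN estimate, NOT PRINTED
and NOT PROVED).  [folklore] finite combinatorics on `ℤᵈ` over the index model of `Balaban1983to89.B16SProfile` (`box`,
`mem_box`, `card_box`) and `Balaban1983to89.B16MergeGeometry` (`Touch`, `TouchConnected`); nothing printed is asserted,
no `def … : Prop` fact of Bałaban's is minted (`ChainPts` below is a parametrised PREDICATE on lists of index points),
no cite-tagged hypothesis, zero `sorry`.  B16 pp. 384–386 under audit; locators only.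

WHY.  In the VOLUME currency of M2 brick B (`Λ K j ^ #(c.2)`), the current domain of a live line is contained in the
radius-31 fattening `P ⊕ B_31 = ⋃_{p ∈ P} □_p^{~31}` of the TOUCH-CONNECTED set `P` of the coarsened cover positions of
all its constituent regions (`B16SProfile.Siter_singleton_subset_box`, `Siter_biUnion`; joins unite TOUCHING parts,
`B16MergeGeometry.Touch`, and coarsening preserves touching, `touch_coarse`).  The naive bound `|P ⊕ B_r| ≤ |P|·(2r+1)^d`
charges one floor unit per constituent for ever; the truth is ONE unit plus a `d∕(2r+1)` fraction of a unit per further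
position, because the boxes of touching positions overlap in all but a face slab.  This is the lemma that makes the
TOTAL-form cost domination of R-OWNER-42-2 hold with room (two adjacent old regions cost `1 + 1∕63` units, not `2`;
journal «PRECISION E-OWNER-42-1»).

WHAT.  §1 two touching boxes: `box p r ∩ box q r` is a product of intervals each of length `≥ 2r`
(`pow_le_card_box_inter_box`), hence `|box q r \ box p r| ≤ (2r+1)^d − (2r)^d ≤ d·(2r+1)^{d−1}`
(`card_box_sdiff_box_le`, with the binomial step `succ_pow_le_add`).  §2 chains: `ChainPts l` (head-first: every point touches
a later member of the list) and `card_biUnion_box_le_of_chainPts`.  §3 every non-empty touch-connected finite set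
admits a chain enumeration (`exists_chainPts`), whence **`card_biUnion_box_le_of_touchConnected`**:
`|P.biUnion (box · r)| ≤ (2r+1)^d + (|P| − 1)·(d·(2r+1)^{d−1})`, and its real-valued form.  §4 sanity (`d = 1`, two
adjacent points, `r = 1`: both sides equal `4`).

HONEST: index-model geometry; NE7b NOT proved; spine 0∕9.  HONEST DEPENDENCY (cell): continuum YM on T⁴ ⇐ BetaPertH ∧
nine spine estimates (0∕9 proved); BetaPertH ⇐ (D1) ∧ (D4) ∧ CAP+tail.  This file changes none of it.
-/

open Finset
open Literature.MathematicalPhysics.QuantumFieldTheory.Balaban1983to89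
open Literature.MathematicalPhysics.QuantumFieldTheory.Balaban1983to89.B13ScaleTransfer
open Literature.MathematicalPhysics.QuantumFieldTheory.Balaban1983to89.B16SProfile
open Literature.MathematicalPhysics.QuantumFieldTheory.Balaban1983to89.B16MergeGeometry

namespace Summit.QuantumFields.BalabanUV.T4Continuum.HistoryBankingFattenedVolume

variable {d : ℕ}

/-! ## §1 Two touching boxes overlap in all but a face slab -/

/-- The intersection of two boxes is the product of the coordinatewise interval intersections. [folklore] -/
theorem box_inter_box_eq (p q : Pt d) (r : ℕ) :
    box p r ∩ box q r =
      Fintype.piFinset fun i => Finset.Icc (p i - r) (p i + r) ∩ Finset.Icc (q i - r) (q i + r) := by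
  ext y
  rw [Finset.mem_inter, B16SProfile.mem_box, B16SProfile.mem_box, Fintype.mem_piFinset]
  simp only [Finset.mem_inter, Finset.mem_Icc]
  exact ⟨fun h i => ⟨h.1 i, h.2 i⟩, fun h => ⟨fun i => (h i).1, fun i => (h i).2⟩⟩

/-- Two integer intervals of length `2r+1` whose centres differ by at most one share at least `2r` points. [folklore] -/
theorem two_mul_le_card_Icc_inter {a b : ℤ} (h1 : a ≤ b + 1) (h2 : b ≤ a + 1) (r : ℕ) :
    2 * r ≤ (Finset.Icc (a - r) (a + r) ∩ Finset.Icc (b - r) (b + r)).card := by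
  have hsub : Finset.Icc (max a b - r) (min a b + r) ⊆ Finset.Icc (a - r) (a + r) ∩ Finset.Icc (b - r) (b + r) := by
    intro y hy
    rw [Finset.mem_Icc] at hy
    rw [Finset.mem_inter, Finset.mem_Icc, Finset.mem_Icc]
    refine ⟨⟨?_, ?_⟩, ?_, ?_⟩
    · linarith [le_max_left a b, hy.1]
    · linarith [min_le_left a b, hy.2]
    · linarith [le_max_right a b, hy.1]
    · linarith [min_le_right a b, hy.2]
  refine le_trans ?_ (Finset.card_le_card hsub)
  rw [Int.card_Icc]
  have hmm : max a b ≤ min a b + 1 := by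
    rcases le_total a b with hab | hab
    · rw [max_eq_right hab, min_eq_left hab]; exact h2
    · rw [max_eq_left hab, min_eq_right hab]; exact h1
  have hr : (0 : ℤ) ≤ r := by positivity
  have h : ((2 * r : ℕ) : ℤ) ≤ min a b + r + 1 - (max a b - r) := by push_cast; linarith
  exact (Int.le_toNat (by linarith)).2 h

/-- **TOUCHING BOXES SHARE AT LEAST `(2r)^d` CUBES.** [folklore] -/
theorem pow_le_card_box_inter_box {p q : Pt d} (h : Touch p q) (r : ℕ) :
    (2 * r) ^ d ≤ (box p r ∩ box q r).card := by
  rw [box_inter_box_eq, Fintype.card_piFinset]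
  calc (2 * r) ^ d = ∏ _i : Fin d, 2 * r := by rw [Finset.prod_const, Finset.card_univ, Fintype.card_fin]
    _ ≤ ∏ i : Fin d, (Finset.Icc (p i - r) (p i + r) ∩ Finset.Icc (q i - r) (q i + r)).card :=
        Finset.prod_le_prod (fun i _ => Nat.zero_le _) fun i _ => two_mul_le_card_Icc_inter (h i).1 (h i).2 r

/-- The binomial step `(b+1)^n ≤ b^n + n·(b+1)^{n−1}`. [folklore] -/
theorem succ_pow_le_add (b : ℕ) : ∀ n : ℕ, (b + 1) ^ n ≤ b ^ n + n * (b + 1) ^ (n - 1)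
  | 0 => by simp
  | n + 1 => by
      have ih := succ_pow_le_add b n
      rw [Nat.add_sub_cancel]
      rcases Nat.eq_zero_or_pos n with hn | hn
      · subst hn; simp
      · have e : (b + 1) ^ n = (b + 1) ^ (n - 1) * (b + 1) := by
          rw [← pow_succ, Nat.sub_add_cancel hn]
        have hmul : b * (b + 1) ^ (n - 1) ≤ (b + 1) ^ (n - 1) * (b + 1) := by
          rw [mul_comm]; exact Nat.mul_le_mul_left _ (Nat.le_succ b)
        calc (b + 1) ^ (n + 1) = (b + 1) ^ n * b + (b + 1) ^ n := by ring
          _ ≤ (b ^ n + n * (b + 1) ^ (n - 1)) * b + (b + 1) ^ n := by gcongr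
          _ = b ^ (n + 1) + n * (b * (b + 1) ^ (n - 1)) + (b + 1) ^ n := by ring
          _ ≤ b ^ (n + 1) + n * ((b + 1) ^ (n - 1) * (b + 1)) + (b + 1) ^ n := by gcongr
          _ = b ^ (n + 1) + (n + 1) * (b + 1) ^ n := by rw [← e]; ring

/-- **THE FACE SLAB**: the part of a box outside a touching box has at most `(2r+1)^d − (2r)^d ≤ d·(2r+1)^{d−1}` cubes.
[folklore] -/
theorem card_box_sdiff_box_le {p q : Pt d} (h : Touch p q) (r : ℕ) :
    (box q r \ box p r).card ≤ d * (2 * r + 1) ^ (d - 1) := by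
  have hsum := Finset.card_sdiff_add_card_inter (box q r) (box p r)
  rw [card_box] at hsum
  have hint : (2 * r) ^ d ≤ (box q r ∩ box p r).card := pow_le_card_box_inter_box h.symm r
  have hbin := succ_pow_le_add (2 * r) d
  omega

/-! ## §2 Chains of touching positions -/

/-- **CHAIN ENUMERATION** (head-first): the head of the list touches some member of the tail (unless the tail is empty),
and the tail is again a chain — a parametrised predicate on lists of index points; read backwards it says that every
point but the last is touched by a later one. [folklore] -/
def ChainPts : List (Pt d) → Prop
  | [] => True
  | p :: l => (l = [] ∨ ∃ q ∈ l, Touch q p) ∧ ChainPts l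

/-- The empty list is a chain. [folklore] -/
theorem chainPts_nil : ChainPts ([] : List (Pt d)) := trivial

/-- A singleton is a chain. [folklore] -/
theorem chainPts_singleton (p : Pt d) : ChainPts [p] := ⟨Or.inl rfl, trivial⟩

/-- A chain stays a chain when a point touching one of its members is put in front. [folklore] -/
theorem chainPts_cons {l : List (Pt d)} (hl : ChainPts l) {p q : Pt d} (hq : q ∈ l) (hpq : Touch q p) :
    ChainPts (p :: l) := ⟨Or.inr ⟨q, hq, hpq⟩, hl⟩

/-- **THE FATTENED VOLUME ALONG A CHAIN**: for a non-empty chain `l` of index points,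
`|⋃_{p ∈ l} □_p^{~r}| ≤ (2r+1)^d + (l.length − 1)·(d·(2r+1)^{d−1})` — the last box in full, every further box only
through its face slab outside a box it touches. [folklore] -/
theorem card_biUnion_box_le_of_chainPts (r : ℕ) : ∀ (l : List (Pt d)), ChainPts l → l ≠ [] →
    (l.toFinset.biUnion fun p => box p r).card ≤ (2 * r + 1) ^ d + (l.length - 1) * (d * (2 * r + 1) ^ (d - 1))
  | [], _, h => absurd rfl h
  | p :: l, hch, _ => by
      rcases hch with ⟨hhead, htail⟩
      by_cases hnil : l = []
      · subst hnil
        simp [card_box]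
      · have hl := card_biUnion_box_le_of_chainPts r l htail hnil
        obtain ⟨q, hq, hqp⟩ := hhead.resolve_left hnil
        have hsub : box q r ⊆ l.toFinset.biUnion fun p => box p r :=
          Finset.subset_biUnion_of_mem (fun p => box p r) (List.mem_toFinset.2 hq)
        have hunion : (p :: l).toFinset.biUnion (fun p => box p r) =
            box p r ∪ l.toFinset.biUnion fun p => box p r := by
          rw [List.toFinset_cons, Finset.biUnion_insert]
        have e : box p r ∪ (l.toFinset.biUnion fun p => box p r) =
            (box p r \ box q r) ∪ l.toFinset.biUnion fun p => box p r := by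
          ext y; constructor
          · intro hy
            rcases Finset.mem_union.1 hy with h1 | h2
            · by_cases hyq : y ∈ box q r
              · exact Finset.mem_union.2 (Or.inr (hsub hyq))
              · exact Finset.mem_union.2 (Or.inl (Finset.mem_sdiff.2 ⟨h1, hyq⟩))
            · exact Finset.mem_union.2 (Or.inr h2)
          · intro hy
            rcases Finset.mem_union.1 hy with h1 | h2
            · exact Finset.mem_union.2 (Or.inl (Finset.mem_sdiff.1 h1).1)
            · exact Finset.mem_union.2 (Or.inr h2)
        have hslab := card_box_sdiff_box_le hqp r
        have hstep := Finset.card_union_le (box p r \ box q r) (l.toFinset.biUnion fun p => box p r)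
        have hlen : (p :: l).length - 1 = (l.length - 1) + 1 := by
          rw [List.length_cons]
          have := List.length_pos_iff.2 hnil; omega
        rw [hunion, e, hlen, Nat.add_mul, one_mul]
        omega

/-! ## §3 Touch-connected sets admit chain enumerations -/

/-- In a touch-connected family, every proper non-empty subfamily is touched from outside: some cube of `P \ S` touches
a cube of `S`. [folklore] -/
theorem exists_touch_outside {P S : Finset (Pt d)} (hP : TouchConnected P) (hS : S ⊆ P) (hSne : S.Nonempty)
    (hSP : S ≠ P) : ∃ p ∈ P \ S, ∃ q ∈ S, Touch q p := by
  obtain ⟨x, hx⟩ := hSne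
  obtain ⟨y, hyP, hyS⟩ : ∃ y ∈ P, y ∉ S := by
    by_contra hcon; push Not at hcon
    exact hSP (Finset.Subset.antisymm hS hcon)
  have key : ∀ z, Relation.ReflTransGen (TouchStep P) x z → z ∈ S ∨ ∃ p ∈ P \ S, ∃ q ∈ S, Touch q p := by
    intro z hz
    induction hz with
    | refl => exact Or.inl hx
    | @tail b c _ hbc ih =>
        rcases ih with hb | hdone
        · by_cases hc : c ∈ S
          · exact Or.inl hc
          · exact Or.inr ⟨c, Finset.mem_sdiff.2 ⟨hbc.2.1, hc⟩, b, hb, hbc.2.2⟩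
        · exact Or.inr hdone
  rcases key y (hP x (hS hx) y hyP) with hyS' | hdone
  · exact absurd hyS' hyS
  · exact hdone

/-- **CHAIN ENUMERATION OF A TOUCH-CONNECTED SET**: a non-empty touch-connected finite family of cubes is the set of
points of a duplicate-free chain. [folklore] -/
theorem exists_chainPts {P : Finset (Pt d)} (hP : TouchConnected P) (hne : P.Nonempty) :
    ∃ l : List (Pt d), l.Nodup ∧ l.toFinset = P ∧ ChainPts l := by
  classical
  -- grow a chain `l` with `l.toFinset ⊆ P` until it exhausts `P`, by induction on the number of missing points
  suffices h : ∀ n : ℕ, ∀ l : List (Pt d), l ≠ [] → l.Nodup → l.toFinset ⊆ P → ChainPts l →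
      (P \ l.toFinset).card = n → ∃ l' : List (Pt d), l'.Nodup ∧ l'.toFinset = P ∧ ChainPts l' by
    obtain ⟨x, hx⟩ := hne
    refine h _ [x] (List.cons_ne_nil x []) (List.nodup_singleton x) ?_ (chainPts_singleton x) rfl
    intro y hy
    rw [List.toFinset_cons, List.toFinset_nil, Finset.insert_empty, Finset.mem_singleton] at hy
    exact hy ▸ hx
  intro n
  induction n with
  | zero =>
      intro l _ hnd hsub hch hcard
      refine ⟨l, hnd, Finset.Subset.antisymm hsub ?_, hch⟩
      intro y hy
      by_contra hyl
      have hmem : y ∈ P \ l.toFinset := Finset.mem_sdiff.2 ⟨hy, hyl⟩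
      rw [Finset.card_eq_zero.1 hcard] at hmem
      exact absurd hmem (Finset.notMem_empty y)
  | succ n ih =>
      intro l hl hnd hsub hch hcard
      have hSne : l.toFinset.Nonempty := by
        obtain ⟨x, hx⟩ := List.exists_mem_of_ne_nil l hl
        exact ⟨x, List.mem_toFinset.2 hx⟩
      have hSP : l.toFinset ≠ P := by
        intro heq; rw [heq, Finset.sdiff_self, Finset.card_empty] at hcard; exact absurd hcard.symm (Nat.succ_ne_zero n)
      obtain ⟨p, hp, q, hq, hqp⟩ := exists_touch_outside hP hsub hSne hSP
      rw [Finset.mem_sdiff] at hp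
      have hpl : p ∉ l := fun h => hp.2 (List.mem_toFinset.2 h)
      refine ih (p :: l) (List.cons_ne_nil p l) (List.nodup_cons.2 ⟨hpl, hnd⟩) ?_
        (chainPts_cons hch (List.mem_toFinset.1 hq) hqp) ?_
      · intro y hy
        rw [List.toFinset_cons, Finset.mem_insert] at hy
        rcases hy with hy | hy
        · exact hy ▸ hp.1
        · exact hsub hy
      · have e : P \ (p :: l).toFinset = (P \ l.toFinset).erase p := by
          rw [List.toFinset_cons]; ext y
          simp only [Finset.mem_sdiff, Finset.mem_insert, Finset.mem_erase]
          tauto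
        rw [e, Finset.card_erase_of_mem (Finset.mem_sdiff.2 ⟨hp.1, hp.2⟩), hcard]
        rfl

/-- **THE VOLUME OF A FATTENED TOUCH-CONNECTED SET**: for a non-empty touch-connected finite family `P` of index cubes
and any radius `r`, `|⋃_{p ∈ P} □_p^{~r}| ≤ (2r+1)^d + (|P| − 1)·(d·(2r+1)^{d−1})` — ONE full box plus a face slab per
further position. [folklore] -/
theorem card_biUnion_box_le_of_touchConnected {P : Finset (Pt d)} (hP : TouchConnected P) (hne : P.Nonempty)
    (r : ℕ) : (P.biUnion fun p => box p r).card ≤ (2 * r + 1) ^ d + (P.card - 1) * (d * (2 * r + 1) ^ (d - 1)) := by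
  obtain ⟨l, hnd, hlP, hch⟩ := exists_chainPts hP hne
  have hl : l ≠ [] := by
    intro h; subst h
    rw [List.toFinset_nil] at hlP
    exact absurd hlP.symm (Finset.nonempty_iff_ne_empty.1 hne)
  have h := card_biUnion_box_le_of_chainPts r l hch hl
  rw [hlP, ← List.toFinset_card_of_nodup hnd] at h
  rwa [hlP] at h

/-- The same bound, real-valued (the currency of the cost comparison). [folklore] -/
theorem card_biUnion_box_le_of_touchConnected_real {P : Finset (Pt d)} (hP : TouchConnected P) (hne : P.Nonempty)
    (r : ℕ) : ((P.biUnion fun p => box p r).card : ℝ) ≤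
      (2 * r + 1 : ℝ) ^ d + ((P.card : ℝ) - 1) * (d * (2 * r + 1 : ℝ) ^ (d - 1)) := by
  have h := card_biUnion_box_le_of_touchConnected hP hne r
  have h1 : 1 ≤ P.card := Finset.card_pos.2 hne
  have hc : ((P.card - 1 : ℕ) : ℝ) = (P.card : ℝ) - 1 := by
    rw [Nat.cast_sub h1, Nat.cast_one]
  have := (Nat.cast_le (α := ℝ)).2 h
  push_cast at this
  rw [hc] at this
  exact this

/-! ## §4 Sanity -/

/-- `d = 1`, two adjacent points `0`, `1`, radius `1`: the union of the two boxes is `{−1, 0, 1, 2}`, four points, and the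
bound reads `3 + 1·(1·3^0) = 4` — the face-slab bound is attained. [folklore] -/
theorem sanity_two_adjacent :
    (({(fun _ => 0), (fun _ => 1)} : Finset (Pt 1)).biUnion fun p => box p 1).card ≤
      (2 * 1 + 1) ^ 1 + (2 - 1) * (1 * (2 * 1 + 1) ^ (1 - 1)) := by
  have hP : TouchConnected ({(fun _ => 0), (fun _ => 1)} : Finset (Pt 1)) := by
    intro x hx y hy
    simp only [Finset.mem_insert, Finset.mem_singleton] at hx hy
    have ht : ∀ a b : Pt 1, (a = (fun _ => 0) ∨ a = fun _ => 1) → (b = (fun _ => 0) ∨ b = fun _ => 1) → Touch a b := by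
      intro a b ha hb μ
      rcases ha with rfl | rfl <;> rcases hb with rfl | rfl <;> simp
    exact Relation.ReflTransGen.single ⟨by simp [hx], by simp [hy], ht x y hx hy⟩
  have h := card_biUnion_box_le_of_touchConnected hP (by simp) 1
  have hc : ({(fun _ => (0 : ℤ)), (fun _ => 1)} : Finset (Pt 1)).card = 2 := by
    rw [Finset.card_insert_of_notMem, Finset.card_singleton]
    simp only [Finset.mem_singleton]
    intro h0; have := congrFun h0 0; simp at this
  simpa [hc] using h

end Summit.QuantumFields.BalabanUV.T4Continuum.HistoryBankingFattenedVolume
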